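import Literature.Probability.Process.BrownianBridgeToPoint3Lifetime
import Literature.Probability.Process.BrownianBridgeToPoint3Measurable
import Literature.Probability.Process.BrownianBridgeToPoint3Inversion
import Literature.MeasureTheory.RandomSets.AvoidanceFunctional
import HarnessLib

/-!
# The law of the range of Brownian motion in `ℝ³` conditioned to hit a point: probability
measure, endpoints, and the reduction of Kelvin covariance of laws of random compact sets to
avoidance functionals

Topic `Literature/Probability/Process`; theorems only, everything PROVED. Assembles the sibling
files `BrownianBridgeToPoint3Lifetime` (the lifetime law is a probability measure),
`BrownianBridgeToPoint3Measurable` (the range map is Borel) and `BrownianBridgeToPoint3Inversion`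
(the image map `invImage` under the unit inversion `ι`) around the requested notion
`brownianBridgeToPointRangeLaw3 x y` (support statement `KelvinBridgeCovariance`, item
`stmt-CriticalPhenomena-5033` of the route
`Summit.CriticalPhenomena.Ising3DConformalLimit.Theses.MoebiusRestrictionCurrents`):

* `isProbabilityMeasure_brownianBridgeToPointRangeLaw3` (`x ≠ y`) and
  `isFiniteMeasure_brownianBridgeToPointRangeLaw3` (all `x, y`);
* `brownianBridgeToPointRangeLaw3_setOf_start_mem`, `…_setOf_end_mem` — the range contains both
  endpoints with probability one;
* `map_invImage_eq_of_forall_setOf_disjoint` — **reduction of Kelvin covariance to avoidance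
  functionals**: for finite Borel measures `μ, ν` on `NonemptyCompacts ℝ³` not charging
  `{K | 0 ∈ K}`, with equal mass, if `ν {K | K ∩ ι '' U = ∅} = μ {K | K ∩ U = ∅}` for every open
  `U ∌ 0`, then `ν = μ.map invImage` (uniqueness of laws of random compact sets from their
  avoidance functional, `Literature.MeasureTheory.RandomSets.ext_of_forall_measure_setOf_disjoint_eq`,
  Molchanov 2005 Thm. 1.13, plus the bookkeeping of the pole). With `μ = P_{x→y}`, `ν = P_{ιx→ιy}`
  this turns the avoidance form of `KelvinBridgeCovariance` into the push-forward form once the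
  polarity of the pole (`P_{x→y} {K | 0 ∈ K} = 0`) is supplied — done in the sibling file
  `BrownianBridgeToPoint3Kelvin` from `BrownianBridgeToPoint3Polar` (points are polar for the
  bridge).

## References

* I. Molchanov, *Theory of Random Sets*, Springer (2005), Chap. 1, Thm. 1.13. [Molchanov2005]
* J. L. Doob, *Classical Potential Theory and Its Probabilistic Counterpart* (1984), Part 2,
  Ch. X. [Doob1984]
-/

noncomputable section

open MeasureTheory TopologicalSpace Set Metric EuclideanGeometry
open scoped NNReal ENNReal

namespace Literature.Probability.Process

open BrownianBridgeToPoint3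

/-! ### Probability measure and endpoints -/

/-- **The law of the range of Brownian motion from `x` conditioned to hit `y ≠ x` is a
probability measure** on the Hausdorff space of nonempty compact subsets of `ℝ³` (Green identity
for the lifetime law + measurability of the range map). [cite: Doob1984, Part 2 Ch. X] -/
theorem isProbabilityMeasure_brownianBridgeToPointRangeLaw3 {x y : E3} (h : x ≠ y) :
    IsProbabilityMeasure (brownianBridgeToPointRangeLaw3 x y) :=
  ⟨by rw [brownianBridgeToPointRangeLaw3_univ h, hittingTimeLaw_univ h]⟩

/-- The law of the range is a finite measure for all `x, y` (zero for `x = y`); a theorem, to be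
invoked with `haveI`. [folklore] -/
theorem isFiniteMeasure_brownianBridgeToPointRangeLaw3 (x y : E3) :
    IsFiniteMeasure (brownianBridgeToPointRangeLaw3 x y) := by
  by_cases h : x = y
  · subst h
    rw [brownianBridgeToPointRangeLaw3_self]
    infer_instance
  · haveI := isProbabilityMeasure_brownianBridgeToPointRangeLaw3 h
    infer_instance

/-- The range contains the starting point with probability one. [folklore] -/
theorem brownianBridgeToPointRangeLaw3_setOf_start_mem {x y : E3} (h : x ≠ y) :
    brownianBridgeToPointRangeLaw3 x y {K | x ∈ (K : Set E3)} = 1 := by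
  haveI := isProbabilityMeasure_brownianBridgeToPointRangeLaw3 h
  exact (prob_compl_eq_zero_iff (measurableSet_setOf_mem x)).1
    (brownianBridgeToPointRangeLaw3_compl_setOf_start_mem h)

/-- The range contains the end point with probability one. [folklore] -/
theorem brownianBridgeToPointRangeLaw3_setOf_end_mem {x y : E3} (h : x ≠ y) :
    brownianBridgeToPointRangeLaw3 x y {K | y ∈ (K : Set E3)} = 1 := by
  haveI := isProbabilityMeasure_brownianBridgeToPointRangeLaw3 h
  exact (prob_compl_eq_zero_iff (measurableSet_setOf_mem y)).1
    (brownianBridgeToPointRangeLaw3_compl_setOf_end_mem h)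

/-! ### Kelvin covariance: from avoidance functionals to the push-forward -/

/-- The unit inversion is an involution of `ℝ³` (with `ι 0 = 0`). [folklore] -/
theorem unitInv_unitInv (z : E3) : unitInv (unitInv z) = z :=
  inversion_inversion (0 : E3) one_ne_zero z

/-- `ι z = 0 ↔ z = 0`. [folklore] -/
theorem unitInv_eq_zero_iff {z : E3} : unitInv z = 0 ↔ z = 0 := by
  constructor
  · intro h
    rw [← unitInv_unitInv z, h]
    exact inversion_self (0 : E3) 1
  · rintro rfl
    exact inversion_self (0 : E3) 1

/-- Two sets that agree off a null set have the same measure. [folklore] -/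
theorem measure_eq_of_null {α : Type*} [MeasurableSpace α] {μ : Measure α} {Z s t : Set α}
    (hZ : μ Z = 0) (hst : ∀ a ∉ Z, a ∈ s ↔ a ∈ t) : μ s = μ t :=
  measure_congr <| by
    filter_upwards [measure_eq_zero_iff_ae_notMem.1 hZ] with a ha
    exact propext (hst a ha)

/-- **Kelvin covariance of laws of random compact sets: from avoidance functionals to the
push-forward.** Let `μ, ν` be finite Borel measures on `NonemptyCompacts ℝ³` of equal mass which do
not charge `{K | 0 ∈ K}`. If `ν {K | K ∩ ι '' U = ∅} = μ {K | K ∩ U = ∅}` for every open `U ∌ 0`,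
then `ν = μ.map invImage` (`invImage K = ι '' K` off the null event `{0 ∈ K}`). Proof: laws of
random compact sets are determined by their avoidance functional on open sets
(`Literature.MeasureTheory.RandomSets.ext_of_forall_measure_setOf_disjoint_eq`); for an open `V`
put `V' = V ∖ {0}` and `U = ι ⁻¹' V'` (open, `∌ 0`, `ι '' U = V'`): off `{0 ∈ K}` the events
`{K ∩ V = ∅}` and `{K ∩ V' = ∅}` coincide, as do `{ι '' K ∩ V = ∅}` and `{K ∩ U = ∅}`.
[cite: Molchanov2005, Chap. 1, Thm. 1.13] -/
theorem map_invImage_eq_of_forall_setOf_disjoint (μ ν : Measure (NonemptyCompacts E3))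
    [IsFiniteMeasure μ]
    (hμ0 : μ {K | (0 : E3) ∈ (K : Set E3)} = 0) (hν0 : ν {K | (0 : E3) ∈ (K : Set E3)} = 0)
    (huniv : μ univ = ν univ)
    (h : ∀ U : Set E3, IsOpen U → (0 : E3) ∉ U →
      ν {K | Disjoint (K : Set E3) (unitInv '' U)} = μ {K | Disjoint (K : Set E3) U}) :
    ν = μ.map invImage := by
  haveI : IsFiniteMeasure ν := ⟨by rw [← huniv]; exact measure_lt_top μ univ⟩
  refine Literature.MeasureTheory.RandomSets.ext_of_forall_measure_setOf_disjoint_eq ν _ ?_ ?_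
  · rw [Measure.map_apply measurable_invImage MeasurableSet.univ, preimage_univ, huniv]
  intro V hV
  -- the punctured set `V' = V ∖ {0}` and `U = ι ⁻¹' V'`
  set V' : Set E3 := V \ {0} with hV'
  have hV'o : IsOpen V' := hV.sdiff isClosed_singleton
  have h0V' : (0 : E3) ∉ V' := fun h0 => h0.2 rfl
  set U : Set E3 := unitInv ⁻¹' V' with hU
  have hmemU : ∀ z : E3, z ∈ U ↔ unitInv z ∈ V ∧ z ≠ 0 := fun z => by
    simp only [hU, hV', mem_preimage, Set.mem_sdiff, mem_singleton_iff, Ne, unitInv_eq_zero_iff]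
  have h0U : (0 : E3) ∉ U := fun h0 => ((hmemU 0).1 h0).2 rfl
  have hUo : IsOpen U := by
    have hUeq : U = {(0 : E3)}ᶜ ∩ unitInv ⁻¹' V' := by
      ext z
      simp only [mem_inter_iff, mem_compl_iff, mem_singleton_iff]
      exact ⟨fun hz => ⟨((hmemU z).1 hz).2, hz⟩, fun hz => hz.2⟩
    rw [hUeq]
    exact continuousOn_unitInv.isOpen_inter_preimage isOpen_compl_singleton hV'o
  have hιU : unitInv '' U = V' := by
    ext z
    constructor
    · rintro ⟨w, hw, rfl⟩
      exact hw
    · intro hz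
      exact ⟨unitInv z, show unitInv (unitInv z) ∈ V' by rwa [unitInv_unitInv], unitInv_unitInv z⟩
  have key := h U hUo h0U
  rw [hιU] at key
  -- left-hand side: `{K ∩ V = ∅}` and `{K ∩ V' = ∅}` agree off `{0 ∈ K}`
  have lhs : ν {K : NonemptyCompacts E3 | Disjoint (K : Set E3) V}
      = ν {K : NonemptyCompacts E3 | Disjoint (K : Set E3) V'} := by
    refine measure_eq_of_null hν0 fun K hK => ⟨fun hd => hd.mono_right sdiff_subset, fun hd => ?_⟩
    rw [mem_setOf_eq, Set.disjoint_left] at hd ⊢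
    intro a haK haV
    exact hd haK ⟨haV, fun ha0 => hK (by rw [mem_singleton_iff] at ha0; exact ha0 ▸ haK)⟩
  -- right-hand side: `{ι '' K ∩ V = ∅}` and `{K ∩ U = ∅}` agree off `{0 ∈ K}`
  have rhs : μ (invImage ⁻¹' {K : NonemptyCompacts E3 | Disjoint (K : Set E3) V})
      = μ {K : NonemptyCompacts E3 | Disjoint (K : Set E3) U} := by
    refine measure_eq_of_null hμ0 fun K hK => ?_
    have hK' : (0 : E3) ∉ (K : Set E3) := hK
    rw [mem_preimage, mem_setOf_eq, mem_setOf_eq, coe_invImage_of_notMem hK', Set.disjoint_left,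
      Set.disjoint_left]
    constructor
    · intro hd a haK haU
      exact hd (mem_image_of_mem _ haK) ((hmemU a).1 haU).1
    · rintro hd _ ⟨a, haK, rfl⟩ haV
      exact hd haK ((hmemU a).2 ⟨haV, fun ha0 => hK' (ha0 ▸ haK)⟩)
  rw [Measure.map_apply measurable_invImage
    (Literature.MeasureTheory.RandomSets.measurableSet_setOf_disjoint hV), lhs, key, rhs]

end Literature.Probability.Process
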